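import Mathlib
import Summits.KontsevichZagierPeriods.Zeta5Search.Elimination.DictStarTopCfg
import Summits.KontsevichZagierPeriods.Zeta5Search.WedgeDictionaryCrossContiguity
import HarnessLib

/-!
# The zero-slot STAR from the slot-7 four-term relation — core (cell `pub-zeta5`, fam-elim E-L25b)

HONEST FRAMING: systematic search; no irrationality claim unless certified.  Identities among gen-1's
rational dictionary coefficients `U, W, V` (`coeffU/W/V`) and their slot-7 Plücker coordinates
`casUW, casUV, casVW`; no cellular integral, no numerics, nothing moves a record.

OUR work (Summit side; fam-elim gen 25, 2026-08-21).  gen-1's dictionary STAR node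
(`WedgeDictionaryThreeTerm.DictStar`) is entered by the descent (`PencilDescentSharp`) only at points with a
ZERO slot, where E-L19's interior proof `Elimination.dictStar_at` (two pencils through `P − DS`) does not
apply.  Here the STAR is derived instead from gen-1's FOUR-TERM RELATION ALONG SLOT 7
(`fourTerm_coeff_rel_UWV`: telescoper `topTelescoper`, Newton coefficients `topGamma0…3`), which needs no
positivity of the slots.  With `x` the base point and `P = x + e₁ + e₇` (slots `1, 7`; the file
`DictStarTransport` transports the result to every slot pair by gen-1's `S₇`-symmetry):

* `starLinB` (4T_B): `(d(x)−1)·κ_B·f(P+e₇) − π₇·f(x+e₁) + π₁·f(x+e₇) = λ_B·f(P)` for `f ∈ {U, W, V}`, where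
  `κ_B = (x₁−x₇)(x₀−1−x₁−x₇) = starKappa(P,1,7)`, `π_s = P_s∏_{m≠s}(P₀+1−P_s−P_m)` (`piB1`, `piB7`) and
  `λ_B = lamB x` — the four-term relation at `x`, three partner shifts along the `e₇`-column
  (`coeff_update_sub`, `cfg_shifts7`) and the scalar identities `scalarB0`, `scalarB1` of `DictStarTopCfg`;
* `starWedgeB`: hence `(d(x)−1)κ_B·X(P) + π₇·X(x+e₁) − π₁·X(x+e₇) = 0` for `X ∈ {casUW, casUV, casVW}` —
  the gauge-free form of `DictStar` at `(P; 1, 7)`, valid whenever `x` is in the box, `d(x) ≥ 2`,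
  `x₇ + 2 ≤ x₀`, `x₁ ≤ x₀` (zero slots allowed).

Points are written `cfg x u v t = x + u·e₁ + v·e₂ + t·e₇` (`DictStarTopCfg`).
-/

open Finset

namespace Summit.KontsevichZagierPeriods.Zeta5Search.Elimination

open Summit.KontsevichZagierPeriods.Zeta5Search.DualSeries (InBox)
open Summit.KontsevichZagierPeriods.Zeta5Search.WedgeDictionary

/-! ## 4. The partner shifts of the configuration -/

/-- The partner shifts (`coeff_update_sub`) along the `e₇`-column: slot 1 against slot 7 at `x`, `x + e₇`,
`x + 2e₇`, for `U, W, V`. -/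
theorem cfg_shifts7 (x : ℕ → ℤ) (hx : InBox x) (hd : 2 ≤ dOf x) (h7 : x 7 + 2 ≤ x 0) (h1 : x 1 ≤ x 0) :
    ∀ F ∈ [coeffU, coeffW, coeffV],
      F (cfg x 1 0 0) - F (cfg x 0 0 1) = aFac x 1 0 * F x ∧
      F (cfg x 1 0 1) - F (cfg x 0 0 2) = aFac x 1 1 * F (cfg x 0 0 1) ∧
      F (cfg x 1 0 2) - F (cfg x 0 0 3) = aFac x 1 2 * F (cfg x 0 0 2) := by
  obtain ⟨e1, -, -, e10, -⟩ := bump_eq_cfg x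
  have hd0 : 0 ≤ dOf x := by omega
  have hx1 := (hx.2 0 (by simp)).1
  have hx7 := (hx.2 6 (by simp)).1
  have hx2 := hx.2 1 (by simp)
  simp only [Nat.reduceAdd] at hx1 hx7 hx2
  have B001 : InBox (cfg x 0 0 1) := inBox_cfg x hx le_rfl le_rfl (by norm_num) (by omega) (by omega) (by omega)
  have B002 : InBox (cfg x 0 0 2) := inBox_cfg x hx le_rfl le_rfl (by norm_num) (by omega) (by omega) (by omega)
  have c1 := cus_bump x hx hd0 (i := 0) (k := 6) (by norm_num) (by norm_num) h1
    (show x 7 ≤ x 0 by omega)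
  have c4 := cus_bump (cfg x 0 0 1) B001 (by rw [dOf_cfg]; omega) (i := 0) (k := 6) (by norm_num) (by norm_num)
    (by rw [cfg_one, cfg_zero]; omega) (by rw [cfg_seven, cfg_zero]; omega)
  have c6 := cus_bump (cfg x 0 0 2) B002 (by rw [dOf_cfg]; omega) (i := 0) (k := 6) (by norm_num) (by norm_num)
    (by rw [cfg_one, cfg_zero]; omega) (by rw [cfg_seven, cfg_zero]; omega)
  rw [e10, e1] at c1
  rw [bump0_cfg, bump6_cfg] at c4 c6
  simp only [Nat.reduceAdd, Int.reduceAdd, cfg_zero, cfg_one, cfg_seven, add_zero] at c1 c4 c6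
  push_cast at c1 c4 c6
  intro F hF
  simp only [List.mem_cons, List.mem_nil_iff, or_false] at hF
  simp only [aFac]
  push_cast
  rcases hF with rfl | rfl | rfl
  · exact ⟨by linear_combination c1.1, by linear_combination c4.1, by linear_combination c6.1⟩
  · exact ⟨by linear_combination c1.2.1, by linear_combination c4.2.1, by linear_combination c6.2.1⟩
  · exact ⟨by linear_combination c1.2.2, by linear_combination c4.2.2, by linear_combination c6.2.2⟩

/-! ## 5. The linear form (4T_B) -/

/-- Pure algebra of (4T_B). -/
theorem linB_of {γ0 γ1 γ2 γ3 κ π1 π7 lam dm1 a1 a1p a1pp f0 f1 f2 f3 g1 g17 g127 : ℚ}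
    (FT : γ3 * f3 + γ2 * f2 + γ1 * f1 + γ0 * f0 = 0) (c1 : g1 - f1 = a1 * f0) (c4 : g17 - f2 = a1p * f1)
    (c6 : g127 - f3 = a1pp * f2) (h3 : γ3 = -dm1) (hlam : lam = κ * (γ2 + dm1 * a1pp))
    (F1 : -lam * a1p - π7 + π1 + κ * γ1 = 0) (F0 : -π7 * a1 + κ * γ0 = 0) :
    dm1 * κ * g127 - π7 * g1 + π1 * f1 = lam * g17 := by
  linear_combination (dm1 * κ) * c6 + (-π7) * c1 + (-lam) * c4 + (-κ) * FT + f1 * F1 + f0 * F0 + (-f2) * hlam +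
    (κ * f3) * h3

/-- The four-term relation along slot 7 (`fourTerm_coeff_rel_UWV`) in configuration coordinates. -/
theorem fourTerm_cfg (x : ℕ → ℤ) (hx : InBox x) (hd : 2 ≤ dOf x) (h7 : x 7 + 2 ≤ x 0) :
    ∀ F ∈ [coeffU, coeffW, coeffV],
      topGamma3 x * F (cfg x 0 0 3) + topGamma2 x * F (cfg x 0 0 2) + topGamma1 x * F (cfg x 0 0 1) +
        topGamma0 x * F x = 0 := by
  obtain ⟨e1, e2, e3, -, -⟩ := bump_eq_cfg x
  obtain ⟨FU, FW, FV⟩ := fourTerm_coeff_rel_UWV x hx hd h7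
  rw [e3, e2, e1] at FU FW FV
  intro F hF
  simp only [List.mem_cons, List.mem_nil_iff, or_false] at hF
  rcases hF with rfl | rfl | rfl
  · exact FU
  · exact FW
  · exact FV

/-- **(4T_B) — the linear form of the STAR at `(P; 1, 7)`, `P = x + e₁ + e₇`.**  For `x` in the box with
`d(x) ≥ 2`, `x₇ + 2 ≤ x₀`, `x₁ ≤ x₀`:
`(d(x)−1)κ_B·f(P+e₇) − π₇·f(x+e₁) + π₁·f(x+e₇) = λ_B·f(P)` for `f = U, W, V`. -/
theorem starLinB (x : ℕ → ℤ) (hx : InBox x) (hd : 2 ≤ dOf x) (h7 : x 7 + 2 ≤ x 0) (h1 : x 1 ≤ x 0) :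
    ∀ F ∈ [coeffU, coeffW, coeffV],
      ((dOf x : ℚ) - 1) * kapB x * F (cfg x 1 0 2) - piB7 x * F (cfg x 1 0 0) + piB1 x * F (cfg x 0 0 1) =
        lamB x * F (cfg x 1 0 1) := by
  intro F hF
  have FT := fourTerm_cfg x hx hd h7 F hF
  obtain ⟨c1, c4, c6⟩ := cfg_shifts7 x hx hd h7 h1 F hF
  exact linB_of FT c1 c4 c6 (topGamma3_eq x) rfl (scalarB1 x) (scalarB0 x)

/-! ## 6. The gauge-free STAR (wedge form) -/

/-- **The STAR at `(P; 1, 7)`, `P = x + e₁ + e₇`, in gauge-free form:**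
`(d(x)−1)κ_B·X(P) + π₇·X(x+e₁) − π₁·X(x+e₇) = 0` for `X ∈ {casUW, casUV, casVW}` — for every `x` in the box
with `d(x) ≥ 2`, `x₇ + 2 ≤ x₀`, `x₁ ≤ x₀`. -/
theorem starWedgeB (x : ℕ → ℤ) (hx : InBox x) (hd : 2 ≤ dOf x) (h7 : x 7 + 2 ≤ x 0) (h1 : x 1 ≤ x 0) :
    ∀ X ∈ [casUW, casUV, casVW],
      ((dOf x : ℚ) - 1) * kapB x * X (cfg x 1 0 1) + piB7 x * X (cfg x 1 0 0) -
        piB1 x * X (cfg x 0 0 1) = 0 := by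
  have L := starLinB x hx hd h7 h1
  have S := cfg_shifts7 x hx hd h7 h1
  obtain ⟨-, cU4, -⟩ := S coeffU (by simp)
  obtain ⟨-, cW4, -⟩ := S coeffW (by simp)
  obtain ⟨-, cV4, -⟩ := S coeffV (by simp)
  have TU := L coeffU (by simp)
  have TW := L coeffW (by simp)
  have TV := L coeffV (by simp)
  intro X hX
  simp only [List.mem_cons, List.mem_nil_iff, or_false] at hX
  rcases hX with rfl | rfl | rfl
  · simp only [casUW, bump6_cfg, Int.reduceAdd]
    linear_combination coeffU (cfg x 1 0 1) * TW - coeffW (cfg x 1 0 1) * TU +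
      (piB1 x * coeffU (cfg x 0 0 1)) * cW4 - (piB1 x * coeffW (cfg x 0 0 1)) * cU4
  · simp only [casUV, bump6_cfg, Int.reduceAdd]
    linear_combination coeffU (cfg x 1 0 1) * TV - coeffV (cfg x 1 0 1) * TU +
      (piB1 x * coeffU (cfg x 0 0 1)) * cV4 - (piB1 x * coeffV (cfg x 0 0 1)) * cU4
  · simp only [casVW, bump6_cfg, Int.reduceAdd]
    linear_combination coeffV (cfg x 1 0 1) * TW - coeffW (cfg x 1 0 1) * TV +
      (piB1 x * coeffV (cfg x 0 0 1)) * cW4 - (piB1 x * coeffW (cfg x 0 0 1)) * cV4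

end Summit.KontsevichZagierPeriods.Zeta5Search.Elimination
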